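import Mathlib
import HarnessLib
import Literature.Analysis.FluidPDE.SelfSimilar
import Literature.Analysis.FluidPDE.VectorCalculus
import Literature.Analysis.FluidPDE.ClassicalSolution
import Literature.Analysis.FluidPDE.NSBoundedMildOseenClassical
import Summits.NavierStokesRegularity.NavierStokesRegularity.Theorems.UnthreadedDoorNetFluxNSSpatialAnalyticity
import Summits.NavierStokesRegularity.NavierStokesRegularity.Theorems.UnthreadedDoorAntidynamoVorticityStructure
import Summits.NavierStokesRegularity.NavierStokesRegularity.Theorems.UnthreadedDoorAntidynamoSolidHarmonicProfile
import Summits.NavierStokesRegularity.NavierStokesRegularity.Theorems.UnthreadedDoorAntidynamoHarmonicProfileNondegenerate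

/-!
# Route `UnthreadedDoor` / `ThreadingFlux`, crux `PoloidalLiouville` (stmt-NavierStokesRegularity-1222), antidynamo v2 skeleton
# (sha16 `4ebf5683127b`), rung `stub_singleDegreeRung` (BC5): ★★★ STEP S2 UNDER THE RUNG'S OWN HYPOTHESES — the vorticity of every slice
# is `ĝ(t, ‖x − x₀‖) • (∇P(x − x₀) × (x − x₀))` with `ĝ(t, ·)` real-analytic on `(0, ∞)`

Support file (seat leafhand-ns-unthreadeddoor-1 g0, cell decomp-ns), `--supports stmt-NavierStokesRegularity-1222 --as helper`; theorems only.
Packaging of the hand's S2 bricks against the VERBATIM hypotheses of `StubSingleDegreeRung` (for a non-zero profile `P`; the case `P = 0`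
is the gradient branch `…AntidynamoSingleDegreeRungGradientBranch`, where the slices are constant):

★★★ `singleDegree_vorticity_structure` — for a bounded ancient mild solution (duality class, `ν = 1`) with measurable slices, jointly
smooth on `(−∞,0) × ℝ³`, whose slices have the single-degree form `v t x = gradient φ x + (g ‖x − x₀‖ · P(x − x₀)) • (x − x₀)`
(`φ`, `g` ARBITRARY at each `t`; `P ≠ 0` a solid harmonic of degree `l ≥ 2` in the rung's `MvPolynomial` encoding), at every `t < 0`
there is `ĝ`, real-analytic on `(0, ∞)`, with
  `curl (v t) x = ĝ(‖x − x₀‖) • (∇P(x − x₀) × (x − x₀))`   for all `x ≠ x₀`.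
Inputs: spatial analyticity of the class (tree `PoloidalLiouville.NetFlux.nsSpatialAnalyticity`), pointwise divergence-freeness (weakly
div-free + `C¹`), the junk-robust structure theorem `exists_analytic_coeff_curl_eq` (p795925), and the profile facts for solid harmonics
(`…SolidHarmonicProfile`, `…HarmonicProfileNondegenerate`).

WHAT REMAINS for the rung without the wall (census S3–S5): joint regularity of `ĝ` in `(t, r)`, `Δ(ĝΛ) = (Dĝ)Λ`, and the dynamics
(the (E1) tower (★★) ⇒ `ĝₜ = Dĝ` on the `Λ`-slot for odd `l` ⇒ parabolic Liouville in `ℝ^{2l+3}` ⇒ `ĝ ≡ 0`).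

HONEST LABEL: step S2 only; nothing here proves the rung, the wall, `PoloidalLiouville` (1222) or bears on NS regularity. [folklore]
-/

noncomputable section

-- the summit and its single sub-problem share the name (CONVENTIONS §1)
set_option linter.dupNamespace false

open scoped Topology InnerProductSpace RealInnerProductSpace ContDiff Laplacian
open Filter Set Function Metric MeasureTheory MvPolynomial
open Literature.Analysis.FluidPDE

namespace Summit.NavierStokesRegularity.NavierStokesRegularity.Theorems.PoloidalLiouville.Antidynamo

/-- A non-zero polynomial does not vanish identically as a function on `ℝ³`. [folklore] -/
theorem exists_evalPoly_ne_zero {P : MvPolynomial (Fin 3) ℝ} (hP : P ≠ 0) :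
    ∃ y : EuclideanSpace ℝ (Fin 3), eval (fun i => y i) P ≠ 0 := by
  by_contra h
  push Not at h
  apply hP
  apply MvPolynomial.funext
  intro x
  rw [map_zero]
  have := h (WithLp.toLp 2 x)
  simpa using this

/-- ★★★ STEP S2 UNDER THE RUNG'S HYPOTHESES (non-zero profile).  See the module docstring. [folklore] -/
theorem singleDegree_vorticity_structure
    (v : ℝ → EuclideanSpace ℝ (Fin 3) → EuclideanSpace ℝ (Fin 3)) (x₀ : EuclideanSpace ℝ (Fin 3))
    (hB : Literature.Analysis.FluidPDE.IsBoundedAncientMildSolution 1 v)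
    (hm : ∀ t < 0, AEStronglyMeasurable (v t) volume)
    (hsm : ContDiffOn ℝ (⊤ : ℕ∞) (Function.uncurry v) (Set.Iio 0 ×ˢ Set.univ))
    {l : ℕ} {P : MvPolynomial (Fin 3) ℝ} (hl : 2 ≤ l) (hP : P.IsHomogeneous l) (hP0 : P ≠ 0)
    (hharm : ∀ y : EuclideanSpace ℝ (Fin 3),
      Laplacian.laplacian (fun z : EuclideanSpace ℝ (Fin 3) => MvPolynomial.eval (fun i => z i) P) y = 0)
    (hrep : ∀ t < 0, ∃ (g : ℝ → ℝ) (φ : EuclideanSpace ℝ (Fin 3) → ℝ), ∀ x,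
      v t x = gradient φ x + (g ‖x - x₀‖ * MvPolynomial.eval (fun i => (x - x₀) i) P) • (x - x₀)) :
    ∀ t < 0, ∃ ĝ : ℝ → ℝ, ContDiffOn ℝ ω ĝ (Ioi 0) ∧ ∀ x : EuclideanSpace ℝ (Fin 3), x ≠ x₀ →
      curl (v t) x = ĝ ‖x - x₀‖ •
        cross (gradient (fun z : EuclideanSpace ℝ (Fin 3) => MvPolynomial.eval (fun i => z i) P) (x - x₀)) (x - x₀) := by
  intro t ht
  -- the profile and its properties
  set Q : EuclideanSpace ℝ (Fin 3) → ℝ := fun z => MvPolynomial.eval (fun i => z i) P with hQ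
  have hQω : ContDiff ℝ ω Q := contDiff_omega_evalPoly P
  have hQhom : ∀ r : ℝ, 0 < r → ∀ y : EuclideanSpace ℝ (Fin 3), Q (r • y) = r ^ l * Q y :=
    fun r _ y => evalPoly_smul hP r y
  have hl1 : 1 ≤ l := by omega
  have hQne : ∃ y, Q y ≠ 0 := exists_evalPoly_ne_zero hP0
  have hQnc := exists_near_ne_on_sphere hQω hl1 hQhom hharm hQne
  have hΛd : ∀ W : Set (EuclideanSpace ℝ (Fin 3)), IsOpen W → W.Nonempty → ∃ y ∈ W, cross (gradient Q y) y ≠ 0 :=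
    fun W hW hWne => exists_cross_gradient_ne_zero_of_isOpen hQω hl1 hQhom hharm hQne hW hWne
  have hΛray : ∀ y : EuclideanSpace ℝ (Fin 3), cross (gradient Q y) y ≠ 0 → ∀ r : ℝ, 0 < r →
      cross (gradient Q (r • y)) (r • y) ≠ 0 :=
    fun y hy r hr => cross_gradient_ne_zero_smul (hQω.differentiable (by simp)) hQhom hy hr
  -- the translated slice `w z = v t (z + x₀)` is analytic and divergence free
  have hvan : AnalyticOnNhd ℝ (v t) univ := PoloidalLiouville.NetFlux.nsSpatialAnalyticity v hB hm hsm t ht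
  have hvω : ContDiff ℝ ω (v t) := hvan.contDiff
  set w : EuclideanSpace ℝ (Fin 3) → EuclideanSpace ℝ (Fin 3) := fun z => v t (z + x₀) with hw
  have hwω : ContDiff ℝ ω w := hvω.comp (contDiff_id.add contDiff_const)
  have hsm' : IsSmoothSpaceTimeOn (Iio 0) v := hsm
  have hv1 : ContDiff ℝ 1 (v t) := (hsm'.contDiff_slice ht).of_le (by norm_cast)
  have hdiv : VectorCalculus.IsDivFree (v t) := (hB.isAncientMildSolution.1 t ht).isDivFree_of_contDiff hv1
  have hwdiv : VectorCalculus.IsDivFree w := fun z => by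
    have h1 : fderiv ℝ w z = fderiv ℝ (v t) (z + x₀) := by rw [hw, fderiv_comp_add_right]
    simp only [VectorCalculus.divergence, h1]
    exact hdiv (z + x₀)
  obtain ⟨g, φ, hφ⟩ := hrep t ht
  have hwrep : ∀ z, w z = gradient (fun y => φ (y + x₀)) z + (g ‖z‖ * Q z) • z := by
    intro z
    have hg : gradient (fun y => φ (y + x₀)) z = gradient φ (z + x₀) := by
      rw [gradient, gradient, fderiv_comp_add_right]
    rw [hg, hw]
    simp only [hQ]
    rw [hφ (z + x₀), add_sub_cancel_right]
  obtain ⟨ĝ, hĝ, hcurl⟩ := exists_analytic_coeff_curl_eq hwω hwdiv hQω hQhom hQnc hΛd hΛray hwrep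
  refine ⟨ĝ, hĝ, fun x hx => ?_⟩
  have hcw : curl (v t) x = curl w (x - x₀) := by
    rw [curl_eq_curlCLM, curl_eq_curlCLM, hw, fderiv_comp_add_right, sub_add_cancel]
  rw [hcw]
  exact hcurl (x - x₀) (sub_ne_zero.2 hx)

end Summit.NavierStokesRegularity.NavierStokesRegularity.Theorems.PoloidalLiouville.Antidynamo

end
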